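import Mathlib.Analysis.InnerProductSpace.PiL2
import Mathlib.Analysis.InnerProductSpace.Projection.FiniteDimensional
import Mathlib.Topology.MetricSpace.Basic
import Literature.Geometry.DiscreteGeometry.KissingPatterns
import Literature.MathematicalPhysics.StatisticalMechanics.BarlowStacking
import HarnessLib
import Summits.AtomisticToContinuum.Crystallization.Theorems.HullExactificationCascadeRobustBarlowTemplateDefs

/-!
# Stub `stub_exhaust` for line `registered`
(crux `RobustBarlowTemplate`, stmt-AtomisticToContinuum-12088)

Statement (`stub_exhaust`): in a `δ`-separated configuration `S ⊆ ℝ³` all of whose points are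
`1/20`-good (the rescaled first shell is matched to the FCC or the HCP kissing pattern) and whose
shell relation is reciprocal, every nonempty `M ⊆ S` that contains the shell of each of its points
is all of `S` (robust form of Hales's "no room for further balls", *Dense Sphere Packings* §1.3).

Proof outline (descent on the distance from `S \ M` to `M`).
* `exhaust_cover_fcc` / `exhaust_cover_hcp`: every direction `u` is within `60°` of a pattern
  point, `‖u‖ / 2 ≤ ⟪u, p⟫` (explicit witness by a sign/ordering case analysis, `nlinarith`).
* `exhaust_dist_estimate`: if `m` is at distance `r ≥ 13/10 · d` from `y` and `t` is a shell point
  of `y` in a direction `p` with `⟪m - y, A p⟫ ≥ r / 2`, then `dist t m ≤ r - d / 50`.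
* `exhaust_step`: for `y ∈ S \ M`, `m ∈ M` there is `t ∈ S \ M` with
  `dist t m ≤ dist y m - δ / 50` (`m` is not in the shell of `y` by reciprocity and closedness,
  and shell points of `y` are not in `M` for the same reason).
* `stub_exhaust`: the infimum of `dist y m` over `y ∈ S \ M`, `m ∈ M` cannot be approached.
-/

noncomputable section

namespace Summit.AtomisticToContinuum.Crystallization.Theorems.HullExactificationCascadeRobustBarlowTemplate

open Literature.MathematicalPhysics.StatisticalMechanics Literature.Geometry.DiscreteGeometry
open RealInnerProductSpace

/-- Euclidean `3`-space. -/
local notation "E3" => EuclideanSpace ℝ (Fin 3)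

/-! ### Covering of directions by the two kissing patterns -/

/-- Core of the covering estimate: an integer vector `q = (x, y, z) ∈ T` with `⟪v, q⟫ ≥ 0` and
`N ‖v‖² ≤ 4 ⟪v, q⟫²` yields the point `q / √N` of `scaledPattern T N` with
`‖v‖ / 2 ≤ ⟪v, q / √N⟫`. -/
theorem exhaust_cover_scaled {T : Finset (Fin 3 → ℤ)} {N : ℕ} (hN : N ≠ 0) (v : E3) (x y z : ℤ)
    (hq : ![x, y, z] ∈ T) (h0 : 0 ≤ (x : ℝ) * v 0 + y * v 1 + z * v 2)
    (hsq : (N : ℝ) * (v 0 ^ 2 + v 1 ^ 2 + v 2 ^ 2) ≤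
      4 * ((x : ℝ) * v 0 + y * v 1 + z * v 2) ^ 2) :
    ∃ p ∈ scaledPattern T N, ‖v‖ / 2 ≤ ⟪v, p⟫ := by
  refine ⟨(Real.sqrt N)⁻¹ • intVec ![x, y, z], Finset.mem_image.2 ⟨![x, y, z], hq, rfl⟩, ?_⟩
  have hs : 0 < Real.sqrt N := Real.sqrt_pos.2 (by exact_mod_cast Nat.pos_of_ne_zero hN)
  have hinner : ⟪v, intVec ![x, y, z]⟫ = (x : ℝ) * v 0 + y * v 1 + z * v 2 := by
    simp only [PiLp.inner_apply, RCLike.inner_apply, conj_trivial, Fin.sum_univ_three,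
      intVec_apply, Matrix.cons_val_zero, Matrix.cons_val_one, Matrix.cons_val_two,
      Matrix.head_cons, Matrix.tail_cons]
  have hnormsq : ‖v‖ ^ 2 = v 0 ^ 2 + v 1 ^ 2 + v 2 ^ 2 := by
    rw [EuclideanSpace.real_norm_sq_eq, Fin.sum_univ_three]
  have key : Real.sqrt N * ‖v‖ ≤ 2 * ((x : ℝ) * v 0 + y * v 1 + z * v 2) := by
    refine (abs_le_of_sq_le_sq' ?_ (by linarith)).2
    rw [mul_pow, Real.sq_sqrt (Nat.cast_nonneg N), hnormsq]
    linarith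
  rw [real_inner_smul_right, hinner, le_inv_mul_iff₀ hs]
  linarith

/-- **FCC covering.** Every vector of `ℝ³` is within `60°` of a vertex of the cuboctahedron:
`‖v‖ / 2 ≤ ⟪v, p⟫` for some `p ∈ fccKissingPattern` (take the two coordinates of largest
modulus with their signs). -/
theorem exhaust_cover_fcc (v : E3) : ∃ p ∈ fccKissingPattern, ‖v‖ / 2 ≤ ⟪v, p⟫ := by
  have hN : (2 : ℕ) ≠ 0 := two_ne_zero
  unfold fccKissingPattern
  rcases le_total (v 0 ^ 2) (v 1 ^ 2) with h01 | h01
  · rcases le_total 0 (v 1) with h1 | h1 <;> rcases le_total 0 (v 2) with h2 | h2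
    · exact exhaust_cover_scaled hN v 0 1 1 (by decide) (by push_cast; nlinarith)
        (by push_cast; nlinarith [mul_nonneg h1 h2])
    · exact exhaust_cover_scaled hN v 0 1 (-1) (by decide) (by push_cast; nlinarith)
        (by push_cast; nlinarith [mul_nonneg h1 (neg_nonneg.2 h2)])
    · exact exhaust_cover_scaled hN v 0 (-1) 1 (by decide) (by push_cast; nlinarith)
        (by push_cast; nlinarith [mul_nonneg (neg_nonneg.2 h1) h2])
    · exact exhaust_cover_scaled hN v 0 (-1) (-1) (by decide) (by push_cast; nlinarith)
        (by push_cast; nlinarith [mul_nonneg (neg_nonneg.2 h1) (neg_nonneg.2 h2)])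
  · rcases le_total 0 (v 0) with h1 | h1 <;> rcases le_total 0 (v 2) with h2 | h2
    · exact exhaust_cover_scaled hN v 1 0 1 (by decide) (by push_cast; nlinarith)
        (by push_cast; nlinarith [mul_nonneg h1 h2])
    · exact exhaust_cover_scaled hN v 1 0 (-1) (by decide) (by push_cast; nlinarith)
        (by push_cast; nlinarith [mul_nonneg h1 (neg_nonneg.2 h2)])
    · exact exhaust_cover_scaled hN v (-1) 0 1 (by decide) (by push_cast; nlinarith)
        (by push_cast; nlinarith [mul_nonneg (neg_nonneg.2 h1) h2])
    · exact exhaust_cover_scaled hN v (-1) 0 (-1) (by decide) (by push_cast; nlinarith)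
        (by push_cast; nlinarith [mul_nonneg (neg_nonneg.2 h1) (neg_nonneg.2 h2)])

/-- The six orderings of three reals. -/
theorem exhaust_sort3 (a b c : ℝ) : (a ≤ b ∧ b ≤ c) ∨ (a ≤ c ∧ c ≤ b) ∨ (b ≤ a ∧ a ≤ c) ∨
    (b ≤ c ∧ c ≤ a) ∨ (c ≤ a ∧ a ≤ b) ∨ (c ≤ b ∧ b ≤ a) := by
  rcases le_total a b with h1 | h1 <;> rcases le_total b c with h2 | h2 <;>
    rcases le_total a c with h3 | h3 <;> tauto

/-- **HCP covering.** Every vector of `ℝ³` is within `60°` of a vertex of the anticuboctahedron: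
`‖v‖ / 2 ≤ ⟪v, p⟫` for some `p ∈ hcpKissingPattern`. With the coordinates sorted
`v i ≤ v j ≤ v k`: if `v i ≥ 0` take `3 (e_j + e_k)`, if `v k ≤ 0` take `-(e_j + e_k) - 4 e_i`,
otherwise `3 (e_k - e_i)` (integer model `hcpInt`, scale `√18`). -/
theorem exhaust_cover_hcp (v : E3) : ∃ p ∈ hcpKissingPattern, ‖v‖ / 2 ≤ ⟪v, p⟫ := by
  have hN : (18 : ℕ) ≠ 0 := by norm_num
  unfold hcpKissingPattern
  rcases exhaust_sort3 (v 0) (v 1) (v 2) with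
    ⟨h1, h2⟩ | ⟨h1, h2⟩ | ⟨h1, h2⟩ | ⟨h1, h2⟩ | ⟨h1, h2⟩ | ⟨h1, h2⟩
  · -- `v 0 ≤ v 1 ≤ v 2`
    rcases le_total 0 (v 0) with hi | hi
    · exact exhaust_cover_scaled hN v 0 3 3 (by decide) (by push_cast; nlinarith)
        (by push_cast; nlinarith)
    rcases le_total 0 (v 2) with hk | hk
    · exact exhaust_cover_scaled hN v (-3) 0 3 (by decide) (by push_cast; nlinarith)
        (by push_cast; nlinarith)
    · exact exhaust_cover_scaled hN v (-4) (-1) (-1) (by decide) (by push_cast; nlinarith)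
        (by push_cast; nlinarith)
  · -- `v 0 ≤ v 2 ≤ v 1`
    rcases le_total 0 (v 0) with hi | hi
    · exact exhaust_cover_scaled hN v 0 3 3 (by decide) (by push_cast; nlinarith)
        (by push_cast; nlinarith)
    rcases le_total 0 (v 1) with hk | hk
    · exact exhaust_cover_scaled hN v (-3) 3 0 (by decide) (by push_cast; nlinarith)
        (by push_cast; nlinarith)
    · exact exhaust_cover_scaled hN v (-4) (-1) (-1) (by decide) (by push_cast; nlinarith)
        (by push_cast; nlinarith)
  · -- `v 1 ≤ v 0 ≤ v 2`
    rcases le_total 0 (v 1) with hi | hi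
    · exact exhaust_cover_scaled hN v 3 0 3 (by decide) (by push_cast; nlinarith)
        (by push_cast; nlinarith)
    rcases le_total 0 (v 2) with hk | hk
    · exact exhaust_cover_scaled hN v 0 (-3) 3 (by decide) (by push_cast; nlinarith)
        (by push_cast; nlinarith)
    · exact exhaust_cover_scaled hN v (-1) (-4) (-1) (by decide) (by push_cast; nlinarith)
        (by push_cast; nlinarith)
  · -- `v 1 ≤ v 2 ≤ v 0`
    rcases le_total 0 (v 1) with hi | hi
    · exact exhaust_cover_scaled hN v 3 0 3 (by decide) (by push_cast; nlinarith)
        (by push_cast; nlinarith)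
    rcases le_total 0 (v 0) with hk | hk
    · exact exhaust_cover_scaled hN v 3 (-3) 0 (by decide) (by push_cast; nlinarith)
        (by push_cast; nlinarith)
    · exact exhaust_cover_scaled hN v (-1) (-4) (-1) (by decide) (by push_cast; nlinarith)
        (by push_cast; nlinarith)
  · -- `v 2 ≤ v 0 ≤ v 1`
    rcases le_total 0 (v 2) with hi | hi
    · exact exhaust_cover_scaled hN v 3 3 0 (by decide) (by push_cast; nlinarith)
        (by push_cast; nlinarith)
    rcases le_total 0 (v 1) with hk | hk
    · exact exhaust_cover_scaled hN v 0 3 (-3) (by decide) (by push_cast; nlinarith)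
        (by push_cast; nlinarith)
    · exact exhaust_cover_scaled hN v (-1) (-1) (-4) (by decide) (by push_cast; nlinarith)
        (by push_cast; nlinarith)
  · -- `v 2 ≤ v 1 ≤ v 0`
    rcases le_total 0 (v 2) with hi | hi
    · exact exhaust_cover_scaled hN v 3 3 0 (by decide) (by push_cast; nlinarith)
        (by push_cast; nlinarith)
    rcases le_total 0 (v 0) with hk | hk
    · exact exhaust_cover_scaled hN v 3 0 (-3) (by decide) (by push_cast; nlinarith)
        (by push_cast; nlinarith)
    · exact exhaust_cover_scaled hN v (-1) (-1) (-4) (by decide) (by push_cast; nlinarith)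
        (by push_cast; nlinarith)

/-- Transport of a covering estimate through a linear isometry `A` of `ℝ³` (which is onto):
`‖u‖ / 2 ≤ ⟪u, A p⟫` for some `p ∈ P`. -/
theorem exhaust_cover_map {P : Finset E3} (hP : ∀ v : E3, ∃ p ∈ P, ‖v‖ / 2 ≤ ⟪v, p⟫)
    (A : E3 →ₗᵢ[ℝ] E3) (u : E3) : ∃ p ∈ P, ‖u‖ / 2 ≤ ⟪u, A p⟫ := by
  obtain ⟨v, rfl⟩ : ∃ v, A v = u :=
    LinearMap.surjective_of_injective (f := A.toLinearMap) A.injective u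
  obtain ⟨p, hp, h⟩ := hP v
  exact ⟨p, hp, by rwa [A.inner_map_map, A.norm_map]⟩

/-! ### Consequences of goodness and separation -/

/-- The data of a good point, uniformly over the two patterns: a linear isometry `A` and a
pattern `P` covering all directions, each of whose points is a unit vector realised, up to
`1/20` after rescaling, by a shell point. -/
theorem exhaust_good_data {S : Set E3} {y : E3} (hy : Good S y) :
    ∃ A : E3 →ₗᵢ[ℝ] E3, ∃ P : Finset E3,
      (∀ u : E3, ∃ p ∈ P, ‖u‖ / 2 ≤ ⟪u, A p⟫) ∧
      ∀ p ∈ P, ‖A p‖ = 1 ∧ ∃ t ∈ shell S y, dist ((nnd S y)⁻¹ • (t - y)) (A p) ≤ 1 / 20 := by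
  rcases hy with ⟨A, ⟨e, he⟩ | ⟨e, he⟩⟩
  · refine ⟨A, fccKissingPattern, exhaust_cover_map exhaust_cover_fcc A, fun p hp => ⟨?_, ?_⟩⟩
    · rw [A.norm_map, norm_eq_one_of_mem_fccKissingPattern hp]
    · refine ⟨(e.symm ⟨p, hp⟩ : E3), (e.symm ⟨p, hp⟩).2, ?_⟩
      simpa using he (e.symm ⟨p, hp⟩)
  · refine ⟨A, hcpKissingPattern, exhaust_cover_map exhaust_cover_hcp A, fun p hp => ⟨?_, ?_⟩⟩
    · rw [A.norm_map, norm_eq_one_of_mem_hcpKissingPattern hp]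
    · refine ⟨(e.symm ⟨p, hp⟩ : E3), (e.symm ⟨p, hp⟩).2, ?_⟩
      simpa using he (e.symm ⟨p, hp⟩)

/-- Separation bounds the nearest-neighbour distance from below: `δ ≤ d(y)` as soon as the shell
of `y` (hence `S \ {y}`) is nonempty. -/
theorem exhaust_le_nnd {δ : ℝ} {S : Set E3} (hSep : Sep δ S) {y : E3} (hy : y ∈ S)
    (hne : (shell S y).Nonempty) : δ ≤ nnd S y := by
  obtain ⟨z, hzS, hzy, -⟩ := hne
  refine le_csInf ⟨dist z y, z, ⟨hzS, hzy⟩, rfl⟩ ?_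
  rintro r ⟨t, ⟨htS, hty⟩, rfl⟩
  exact hSep t htS y hy hty

/-! ### The descent step -/

/-- **Geometric core.** If `‖u‖ = r ≥ 13/10 · d`, `q` is a unit vector with `⟪u, q⟫ ≥ r / 2` and
`w` is within `d / 20` of `d • q`, then `‖w - u‖ ≤ r - d / 50`: indeed
`‖w - u‖² ≤ (21/20)² d² - (9/10) d r + r² ≤ (r - d/50)²`. -/
theorem exhaust_dist_estimate {d r : ℝ} (hd : 0 < d) (hr : 13 / 10 * d ≤ r) {u w q : E3}
    (hu : ‖u‖ = r) (hq : ‖q‖ = 1) (hinner : r / 2 ≤ ⟪u, q⟫) (hw : ‖w - d • q‖ ≤ d / 20) :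
    ‖w - u‖ ≤ r - d / 50 := by
  have hw' : w = d • q + (w - d • q) := by abel
  have h1 : 9 / 20 * (d * r) ≤ ⟪w, u⟫ := by
    rw [hw', inner_add_left, real_inner_smul_left, real_inner_comm u q]
    have h3 : ‖w - d • q‖ * ‖u‖ ≤ d / 20 * r := by
      rw [hu]; exact mul_le_mul_of_nonneg_right hw (hu ▸ norm_nonneg u)
    have h4 := abs_real_inner_le_norm (w - d • q) u
    have h5 := neg_abs_le ⟪w - d • q, u⟫
    nlinarith [mul_le_mul_of_nonneg_left hinner hd.le]
  have h2 : ‖w‖ ≤ 21 / 20 * d := by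
    rw [hw']
    calc ‖d • q + (w - d • q)‖ ≤ ‖d • q‖ + ‖w - d • q‖ := norm_add_le _ _
      _ = d + ‖w - d • q‖ := by rw [norm_smul, Real.norm_of_nonneg hd.le, hq, mul_one]
      _ ≤ 21 / 20 * d := by linarith
  have hw2 : ‖w‖ ^ 2 ≤ (21 / 20 * d) ^ 2 := pow_le_pow_left₀ (norm_nonneg w) h2 2
  have hdr : d * (13 / 10 * d) ≤ d * r := mul_le_mul_of_nonneg_left hr hd.le
  have h3 : ‖w - u‖ ^ 2 ≤ (r - d / 50) ^ 2 := by
    rw [norm_sub_sq_real, hu]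
    nlinarith [hw2, h1, hdr]
  exact (abs_le_of_sq_le_sq' h3 (by linarith)).2

/-- **Descent step.** For `y ∈ S \ M` and `m ∈ M` (with `M ⊆ S` shell-closed, all points good,
shells reciprocal, `S` `δ`-separated) there is `t ∈ S \ M` with `dist t m ≤ dist y m - δ / 50`:
`m` is not a shell point of `y` (else `y ∈ shell S m ⊆ M`), so `dist y m ≥ 13/10 · d(y)`; the
shell point `t` of `y` in the pattern direction best aligned with `m - y` is closer to `m` by
`exhaust_dist_estimate`, and `t ∉ M` (else `y ∈ shell S t ⊆ M`). -/
theorem exhaust_step {δ : ℝ} (hδ : 0 < δ) {S : Set E3} (hSep : Sep δ S)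
    (hGood : ∀ y ∈ S, Good S y) (hRecip : Recip S) {M : Set E3}
    (hClosed : ∀ x ∈ M, shell S x ⊆ M) {y m : E3} (hyS : y ∈ S) (hyM : y ∉ M) (hmS : m ∈ S)
    (hm : m ∈ M) : ∃ t ∈ S, t ∉ M ∧ dist t m ≤ dist y m - δ / 50 := by
  have hmy : m ≠ y := fun h => hyM (h ▸ hm)
  obtain ⟨A, P, hcov, hpat⟩ := exhaust_good_data (hGood y hyS)
  have hout : ∀ t ∈ shell S y, t ∉ M := fun t ht htM =>
    hyM (hClosed t htM (hRecip y hyS t ht).1)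
  obtain ⟨p₀, hp₀, -⟩ := hcov 0
  obtain ⟨-, t₀, ht₀, -⟩ := hpat p₀ hp₀
  have hδd : δ ≤ nnd S y := exhaust_le_nnd hSep hyS ⟨t₀, ht₀⟩
  have hd : 0 < nnd S y := hδ.trans_le hδd
  have hfar : 13 / 10 * nnd S y ≤ dist m y := by
    by_contra h
    exact hout m ⟨hmS, hmy, not_le.mp h⟩ hm
  obtain ⟨p, hp, hinner⟩ := hcov (m - y)
  obtain ⟨hAp, t, ht, hdist⟩ := hpat p hp
  refine ⟨t, ht.1, hout t ht, ?_⟩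
  have hw : ‖(t - y) - nnd S y • A p‖ ≤ nnd S y / 20 := by
    rw [dist_eq_norm] at hdist
    have : (t - y) - nnd S y • A p = nnd S y • ((nnd S y)⁻¹ • (t - y) - A p) := by
      rw [smul_sub, smul_smul, mul_inv_cancel₀ hd.ne', one_smul]
    rw [this, norm_smul, Real.norm_of_nonneg hd.le]
    calc nnd S y * ‖(nnd S y)⁻¹ • (t - y) - A p‖ ≤ nnd S y * (1 / 20) :=
          mul_le_mul_of_nonneg_left hdist hd.le
      _ = nnd S y / 20 := by ring
  have hu : ‖m - y‖ = dist y m := by rw [dist_comm, dist_eq_norm]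
  have hr : 13 / 10 * nnd S y ≤ dist y m := by rwa [dist_comm] at hfar
  rw [hu] at hinner
  have key := exhaust_dist_estimate hd hr hu hAp hinner hw
  have htm : dist t m = ‖(t - y) - (m - y)‖ := by rw [sub_sub_sub_cancel_right, dist_eq_norm]
  rw [htm]
  linarith

/-- STUB `stub_exhaust` (registered on stmt-AtomisticToContinuum-12088, line `registered`):
a nonempty shell-closed subset of an everywhere-good separated configuration with reciprocal
shells is the whole configuration. Proof: if `S \ M ≠ ∅`, the set `D` of distances `dist y m`
(`y ∈ S \ M`, `m ∈ M`) is nonempty and bounded below, and by `exhaust_step` every element of `D`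
exceeds another one by at least `δ / 50`, contradicting `sInf D ≤ ·` near the infimum. -/
theorem stub_exhaust :
    ∀ δ : ℝ, 0 < δ → ∀ S : Set E3, Sep δ S → (∀ y ∈ S, Good S y) → Recip S →
      ∀ M : Set E3, M ⊆ S → M.Nonempty → (∀ x ∈ M, shell S x ⊆ M) → S ⊆ M := by
  intro δ hδ S hSep hGood hRecip M hMS hMne hClosed
  by_contra hSM
  obtain ⟨y₀, hy₀S, hy₀M⟩ := Set.not_subset.1 hSM
  obtain ⟨m₀, hm₀⟩ := hMne
  set D : Set ℝ := {r | ∃ y ∈ S, y ∉ M ∧ ∃ m ∈ M, dist y m = r} with hD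
  have hDne : D.Nonempty := ⟨dist y₀ m₀, y₀, hy₀S, hy₀M, m₀, hm₀, rfl⟩
  have hDbdd : BddBelow D := ⟨0, by rintro r ⟨y, -, -, m, -, rfl⟩; exact dist_nonneg⟩
  have hlt : sInf D < sInf D + δ / 50 := by linarith
  obtain ⟨r, ⟨y, hyS, hyM, m, hm, rfl⟩, hr⟩ := exists_lt_of_csInf_lt hDne hlt
  obtain ⟨t, htS, htM, hstep⟩ := exhaust_step hδ hSep hGood hRecip hClosed hyS hyM (hMS hm) hm
  have hle : sInf D ≤ dist t m := csInf_le hDbdd ⟨t, htS, htM, m, hm, rfl⟩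
  linarith

end Summit.AtomisticToContinuum.Crystallization.Theorems.HullExactificationCascadeRobustBarlowTemplate

end
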